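import Literature.MathematicalPhysics.QuantumFieldTheory.ConformalBootstrap3D.BlockExistenceLimit
import Literature.MathematicalPhysics.QuantumFieldTheory.ConformalBootstrap3D.BlockFreeScalarPole
import Mathlib.Tactic
import HarnessLib

/-!
# Satisfiability of the typed block clause A2 of the `σ–ε` system: the complete answer

For which `(Δ, ℓ, Δ₁₂, Δ₃₄)` allowed by three-dimensional unitarity does SOME function satisfy the typed
predicate `IsConformalBlock3D Δ₁₂ Δ₃₄ Δ ℓ` of `SigmaEpsilonSystem` (pub-ising3d paper, Limitation (a))?
This file only assembles the answer from the six files that prove it: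

* existence strictly above the unitarity bound for ALL external dimensions, regular and accidental points
  (`BlockExistenceAB`, `BlockExistenceLimitAB`: `exists_isConformalBlock3D_of_lt`);
* existence AT the bound `Δ = ℓ + 1`, `ℓ ≥ 1`, for equal external dimensions — conserved currents, the stress
  tensor (`BlockExistence`, `BlockExistenceLimit`: `exists_isConformalBlock3D_of_isAdmissible`);
* NON-existence at the bound `Δ = ℓ + 1`, `ℓ ≥ 1`, for `Δ₁₂ Δ₃₄ ≠ 0` — the type III pole
  (`BlockPoleNonexistence`: `not_isConformalBlock3D_of_pole`);
* NON-existence at the free-scalar point `(1/2, 0)` for `|Δ₁₂|, |Δ₃₄| ≠ 1/2`, in particular for equal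
  external dimensions — the type II pole (`BlockFreeScalarPole`: `not_isConformalBlock3D_freeScalar`).

Results (`Δ₀ ≥ unitarityBound3D ℓ` throughout):
* `exists_isConformalBlock3D_zero_zero_iff` — `Δ₁₂ = Δ₃₄ = 0` (the `⟨σσσσ⟩`, `⟨εεεε⟩` channels): a typed
  block exists iff `(Δ₀, ℓ) ≠ (1/2, 0)`;
* `exists_isConformalBlock3D_iff_bound_lt` — `Δ₁₂ Δ₃₄ ≠ 0` and `|Δ₁₂|, |Δ₃₄| ≠ 1/2` (the `⟨σεσε⟩`,
  `⟨εσσε⟩` channels with `Δ_σ ≠ Δ_ε`, `|Δ_σ - Δ_ε| ≠ 1/2`): a typed block exists iff `Δ₀` is STRICTLY above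
  the bound;
* `SigmaEpsilonData.exists_gpm_iff` / `exists_gmm_iff` — the same, stated for the two odd-sector block
  families of a `σ–ε` datum.
So clause A2 silently removes from the operator content exactly: a dimension-`1/2` scalar in `σ × σ`,
`ε × ε`; and, when `Δ_σ ≠ Δ_ε`, spin-`ℓ ≥ 1` operators at `Δ = ℓ + 1` and (if `|Δ_σ - Δ_ε| ≠ 1/2`) a
dimension-`1/2` scalar in `σ × ε` — the free field and the conserved currents, which the equation of motion and
the Ward identity remove in a CFT (Kos–Poland–Simmons-Duffin 2014 §4). Nothing else.

References: F. Kos, D. Poland, D. Simmons-Duffin, JHEP 11 (2014) 109, §4 eqs. (4.2)–(4.3), Table 1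
[cite: KosPolandSimmonsduffin2014, §4 eqs. (4.2)–(4.3)]; F. A. Dolan, H. Osborn, Nucl. Phys. B 678 (2004) 491,
§3 [cite: DolanOsborn2004, §3 eqs. (3.11)–(3.12)].
-/

namespace Literature.MathematicalPhysics.QuantumFieldTheory.ConformalBootstrap3D

open Set

/-- **Equal external dimensions** (`⟨σσσσ⟩`, `⟨εεεε⟩`): for `Δ₀ ≥ unitarityBound3D ℓ` a function satisfying
`IsConformalBlock3D 0 0 Δ₀ ℓ` exists iff `(Δ₀, ℓ)` is not the free-scalar point `(1/2, 0)`.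
[cite: KosPolandSimmonsduffin2014, §4 eqs. (4.2)–(4.3)] -/
theorem exists_isConformalBlock3D_zero_zero_iff {ℓ : ℕ} {Δ₀ : ℝ} (h : unitarityBound3D ℓ ≤ Δ₀) :
    (∃ g : ℝ → ℝ → ℝ, IsConformalBlock3D 0 0 Δ₀ ℓ g) ↔ ¬ (ℓ = 0 ∧ Δ₀ = 1 / 2) := by
  constructor
  · rintro ⟨g, hg⟩ ⟨hℓ, hΔ⟩
    subst hℓ
    rw [hΔ] at hg
    exact not_isConformalBlock3D_freeScalar_zero_zero g hg
  · intro hne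
    refine exists_isConformalBlock3D_of_isAdmissible ⟨h, fun hℓ => ?_⟩
    subst hℓ
    have hb : unitarityBound3D 0 = 1 / 2 := by simp [unitarityBound3D]
    rw [hb] at h ⊢
    exact lt_of_le_of_ne h (fun heq => hne ⟨rfl, heq.symm⟩)

/-- **Unequal external dimensions, generic** (`Δ₁₂ Δ₃₄ ≠ 0` and `|Δ₁₂|, |Δ₃₄| ≠ 1/2`): for
`Δ₀ ≥ unitarityBound3D ℓ` a function satisfying `IsConformalBlock3D Δ₁₂ Δ₃₄ Δ₀ ℓ` exists iff `Δ₀` is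
strictly above the unitarity bound. [cite: KosPolandSimmonsduffin2014, §4 eqs. (4.2)–(4.3)] -/
theorem exists_isConformalBlock3D_iff_bound_lt {Δ₁₂ Δ₃₄ : ℝ} (h12 : Δ₁₂ * Δ₃₄ ≠ 0)
    (hhalf : (4 * Δ₁₂ ^ 2 - 1) * (4 * Δ₃₄ ^ 2 - 1) ≠ 0) {ℓ : ℕ} {Δ₀ : ℝ}
    (h : unitarityBound3D ℓ ≤ Δ₀) :
    (∃ g : ℝ → ℝ → ℝ, IsConformalBlock3D Δ₁₂ Δ₃₄ Δ₀ ℓ g) ↔ unitarityBound3D ℓ < Δ₀ := by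
  constructor
  · rintro ⟨g, hg⟩
    refine lt_of_le_of_ne h (fun heq => ?_)
    rw [← heq] at hg
    rcases Nat.eq_zero_or_pos ℓ with hℓ | hℓ
    · subst hℓ
      have hb : unitarityBound3D 0 = 1 / 2 := by simp [unitarityBound3D]
      rw [hb] at hg
      exact not_isConformalBlock3D_freeScalar hhalf g hg
    · have hb : unitarityBound3D ℓ = (ℓ : ℝ) + 1 := by
        unfold unitarityBound3D; rw [if_neg (by omega)]
      rw [hb] at hg
      exact not_isConformalBlock3D_of_pole h12 hℓ g hg
  · intro hlt
    exact exists_isConformalBlock3D_of_lt Δ₁₂ Δ₃₄ hlt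

namespace SigmaEpsilonData

/-- For a `σ–ε` datum with `Δ_σ ≠ Δ_ε` and `|Δ_σ - Δ_ε| ≠ 1/2`: a typed `⟨εσσε⟩` block `g^{-Δ_σε,Δ_σε}_{Δ,ℓ}`
exists at `Δ ≥ unitarityBound3D ℓ` iff `Δ` is strictly above the bound. [cite: KosPolandSimmonsduffin2014, §4 eqs. (4.2)–(4.3)] -/
theorem exists_gpm_iff (D : SigmaEpsilonData) (hne : D.Δσ ≠ D.Δε) (hs : 4 * D.Δσε ^ 2 ≠ 1)
    {ℓ : ℕ} {Δ : ℝ} (h : unitarityBound3D ℓ ≤ Δ) :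
    (∃ g : ℝ → ℝ → ℝ, IsConformalBlock3D (-D.Δσε) D.Δσε Δ ℓ g) ↔ unitarityBound3D ℓ < Δ := by
  have hs0 : D.Δσε ≠ 0 := sub_ne_zero.mpr hne
  have h1 : 4 * D.Δσε ^ 2 - 1 ≠ 0 := sub_ne_zero.mpr hs
  refine exists_isConformalBlock3D_iff_bound_lt (mul_ne_zero (neg_ne_zero.mpr hs0) hs0) ?_ h
  rw [neg_sq]
  exact mul_ne_zero h1 h1

/-- The same for the `⟨σεσε⟩` family `g^{Δ_σε,Δ_σε}_{Δ,ℓ}`. [cite: KosPolandSimmonsduffin2014, §4 eqs. (4.2)–(4.3)] -/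
theorem exists_gmm_iff (D : SigmaEpsilonData) (hne : D.Δσ ≠ D.Δε) (hs : 4 * D.Δσε ^ 2 ≠ 1)
    {ℓ : ℕ} {Δ : ℝ} (h : unitarityBound3D ℓ ≤ Δ) :
    (∃ g : ℝ → ℝ → ℝ, IsConformalBlock3D D.Δσε D.Δσε Δ ℓ g) ↔ unitarityBound3D ℓ < Δ := by
  have hs0 : D.Δσε ≠ 0 := sub_ne_zero.mpr hne
  have h1 : 4 * D.Δσε ^ 2 - 1 ≠ 0 := sub_ne_zero.mpr hs
  exact exists_isConformalBlock3D_iff_bound_lt (mul_ne_zero hs0 hs0) (mul_ne_zero h1 h1) h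

end SigmaEpsilonData

end Literature.MathematicalPhysics.QuantumFieldTheory.ConformalBootstrap3D
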